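import Summits.ValiantsHypothesis.ValiantsHypothesis.Theorems.BarrierLeverAnchoredDoorHitsLowerPairsAnchorSets

/-!
# Support item `AnchoredDoorHitsLowerPairs` (stmt-ValiantsHypothesis-22510), line `anchored-peeling`:
# the anchor-set expansion, part 2 — CLOSED FORM of the one-sided coefficients `xcoeff`, `ycoeff`

Helper file (`--supports stmt-ValiantsHypothesis-22510`; cell valiant-natproofs, rung V4, 𝒟-side door (c); registered line
`Cruxes/AnchoredDoorHitsLowerPairs/Lines/anchored_peeling.lean` v5; prover seat val-np-p4 gen 17). Bookkeeping `def`s `xTwist`, `yTwist`,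
`xFoot`, `yFoot`. Closes NO item. Continues `…AnchorSets` (p590167: `[x^U y^W] symbolicWitness s h = Σ_{J ⊆ anchors s h} θ^J ·
xcoeff U J · ycoeff W J`, layout matrix `= P · D_θ · Q` with `P[i, J] = xcoeff (u i) J`, `Q[J, j] = ycoeff (w j) J`).

THE MATRICES `P` AND `Q` EXPLICITLY (every profile `s`, every `h`). For a set `J` of anchors `α = (A_α | B_α)` write
`xFoot J = ⋃_α A_α`, `φ_α^D = ∏_{b ∈ D} φ_{α b}` (`xTwist`):
* `xPart_eq_sum`: `xPart α = Σ_{D ⊆ A_αᶜ} φ_α^D · x^{A_α ∪ D}`;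
* `xcoeff_insert` (**recursion**): for `α ∉ J`, `xcoeff U (insert α J) = [A_α ⊆ U] · Σ_{D ⊆ U ∖ A_α} φ_α^D · xcoeff ((U ∖ A_α) ∖ D) J`;
* `xcoeff_eq` (**closed form**): `xcoeff U J = [the A_α, α ∈ J, are pairwise disjoint] · [xFoot J ⊆ U] · ∏_{b ∈ U ∖ xFoot J} (Σ_{α ∈ J} φ_{α b})`
  — a column of `P` is nonzero exactly on the rows containing its `x`-footprint, provided the `x`-parts do not collide, and there it
  is the product over the remaining row vertices of the SUMMED twists of `J` (each remaining vertex is absorbed by exactly one anchor,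
  independently); `xcoeff_singleton`: one anchor gives the tail monomial `[A ⊆ U] φ_α^{U ∖ A}` of `…DistinctAnchorsSpec`;
* the mirror statements `yPart_eq_sum`, `ycoeff_insert`, `ycoeff_eq`, `ycoeff_singleton` for `Q`.
For `s = 1` the anchor sets with a nonzero column of `P` AND a nonzero row of `Q` are the partial matchings `J` of `K_{h,h}`, and
`P[U, J] = [a(J) ⊆ U] ∏_{b ∈ U ∖ a(J)} (Σ_{α ∈ J} φ_{α b})`: val-np-p4 g16's first-order matrix `E¹ = P¹ · Q¹` (`…DistinctAnchors`) is the
restriction to singletons, and the Cauchy–Binet form of `…AnchorSets` (`symbolicDet_eq_sum_injective`) becomes a sum over `r`-families of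
matchings (memo HOME/val-np-p4/g17/MEMO-anchor-set-expansion-valnp4-g17.md: squarefree families = the Hall regime; beyond `#anchors` rows
every monomial of `symbolicDet` repeats an anchor).

WHAT THIS IS NOT: identities only; nothing on which pairs are hit, on items 22510 / 19717 themselves, on crux stmt-ValiantsHypothesis-14610,
or on `VP` versus `VNP`.
-/

set_option linter.dupNamespace false

namespace Summit.ValiantsHypothesis.ValiantsHypothesis.Theorems.BarrierLever.AnchoredPeeling

open Finset MvPolynomial
open Summit.ValiantsHypothesis.ValiantsHypothesis.Theorems.BarrierLever.BrickCalculus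
  (pexpo pexpo_def pexpo_le_iff pexpo_sub pexpo_apply_castAdd pexpo_apply_natAdd)

noncomputable section

namespace AnchorSets

variable {h : ℕ}

/-! ## 5. Closed form of the one-sided coefficients -/

/-- The `x`-twist monomial of the anchor `α` on a set `D`: `φ_α^D = ∏_{b ∈ D} φ_{α b}`. -/
def xTwist (α : Finset (Fin h) × Finset (Fin h)) (D : Finset (Fin h)) : MvPolynomial (Param h) ℂ :=
  ∏ b ∈ D, X (Sum.inr (Sum.inl (α, b)))

/-- The `y`-twist monomial of the anchor `α` on a set `D`: `ψ_α^D = ∏_{d ∈ D} ψ_{α d}`. -/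
def yTwist (α : Finset (Fin h) × Finset (Fin h)) (D : Finset (Fin h)) : MvPolynomial (Param h) ℂ :=
  ∏ d ∈ D, X (Sum.inr (Sum.inr (α, d)))

/-- `xPart α = Σ_{D ⊆ Aᶜ} φ_α^D · x^{A ∪ D}`. -/
theorem xPart_eq_sum (α : Finset (Fin h) × Finset (Fin h)) :
    xPart α = ∑ D ∈ (univ \ α.1).powerset, monomial (pexpo (α.1 ∪ D) ∅) (xTwist α D) := by
  rw [xPart, prod_X_eq_monomial', ProductRule.prod_one_add_C_mul_X_fun, Finset.mul_sum]
  refine Finset.sum_congr rfl (fun D hD => ?_)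
  have hdisj : Disjoint α.1 D := by
    rw [Finset.mem_powerset] at hD
    exact Finset.disjoint_of_subset_right hD Finset.disjoint_sdiff
  rw [monomial_mul, one_mul, xTwist, ← Finset.union_empty (∅ : Finset (Fin h)),
    pexpo_union hdisj (Finset.disjoint_empty_left ∅), pexpo_def, pexpo_def, Finset.sum_empty, add_zero, add_zero]

/-- `yPart α = Σ_{D ⊆ Bᶜ} ψ_α^D · y^{B ∪ D}`. -/
theorem yPart_eq_sum (α : Finset (Fin h) × Finset (Fin h)) :
    yPart α = ∑ D ∈ (univ \ α.2).powerset, monomial (pexpo ∅ (α.2 ∪ D)) (yTwist α D) := by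
  rw [yPart, prod_X_eq_monomial', ProductRule.prod_one_add_C_mul_X_fun, Finset.mul_sum]
  refine Finset.sum_congr rfl (fun D hD => ?_)
  have hdisj : Disjoint α.2 D := by
    rw [Finset.mem_powerset] at hD
    exact Finset.disjoint_of_subset_right hD Finset.disjoint_sdiff
  rw [monomial_mul, one_mul, yTwist, ← Finset.union_empty (∅ : Finset (Fin h)),
    pexpo_union (Finset.disjoint_empty_left ∅) hdisj, pexpo_def, pexpo_def, Finset.sum_empty, zero_add, zero_add]

/-- **Recursion for the `x`-coefficient:** adding the anchor `α = (A | B)` to the set `J`,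
`xcoeff U (insert α J) = [A ⊆ U] · Σ_{D ⊆ U ∖ A} φ_α^D · xcoeff ((U ∖ A) ∖ D) J`
(the new anchor takes its `x`-part `A` out of the row and absorbs an arbitrary part `D` of the rest into its twist). -/
theorem xcoeff_insert {α : Finset (Fin h) × Finset (Fin h)} {J : Finset (Finset (Fin h) × Finset (Fin h))} (hα : α ∉ J)
    (U : Finset (Fin h)) :
    xcoeff U (insert α J) =
      if α.1 ⊆ U then ∑ D ∈ (U \ α.1).powerset, xTwist α D * xcoeff ((U \ α.1) \ D) J else 0 := by
  classical
  rw [xcoeff, Finset.prod_insert hα, xPart_eq_sum, Finset.sum_mul, coeff_sum]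
  simp_rw [coeff_monomial_mul']
  by_cases hA : α.1 ⊆ U
  · rw [if_pos hA]
    have hT : U \ α.1 ⊆ univ \ α.1 := Finset.sdiff_subset_sdiff (Finset.subset_univ U) subset_rfl
    rw [show (U \ α.1).powerset = ((univ \ α.1).powerset).filter (fun D => D ⊆ U \ α.1) from ?_, Finset.sum_filter]
    · refine Finset.sum_congr rfl (fun D hD => ?_)
      rw [Finset.mem_powerset] at hD
      by_cases hDU : D ⊆ U \ α.1
      · have hsub : α.1 ∪ D ⊆ U := Finset.union_subset hA (hDU.trans Finset.sdiff_subset)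
        rw [if_pos hDU, if_pos ((pexpo_le_iff _ _ _ _).mpr ⟨hsub, subset_rfl⟩), pexpo_sub _ _ _ _ hsub subset_rfl,
          Finset.sdiff_empty, xcoeff, sdiff_sdiff_left, Finset.sup_eq_union]
      · rw [if_neg hDU, if_neg]
        intro hle
        apply hDU
        have hAD := ((pexpo_le_iff _ _ _ _).mp hle).1
        intro b hb
        rw [Finset.mem_sdiff]
        refine ⟨hAD (Finset.mem_union_right _ hb), fun hbA => ?_⟩
        have hb' := hD hb
        rw [Finset.mem_sdiff] at hb'
        exact hb'.2 hbA
    · ext D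
      simp only [Finset.mem_powerset, Finset.mem_filter]
      exact ⟨fun hD => ⟨hD.trans hT, hD⟩, fun hD => hD.2⟩
  · rw [if_neg hA]
    refine Finset.sum_eq_zero (fun D _ => ?_)
    rw [if_neg]
    intro hle
    exact hA (Finset.subset_union_left.trans ((pexpo_le_iff _ _ _ _).mp hle).1)

/-- The `x`-footprint of a set of anchors: `⋃_{α ∈ J} A_α`. -/
def xFoot (J : Finset (Finset (Fin h) × Finset (Fin h))) : Finset (Fin h) := J.biUnion Prod.fst

/-- The `x`-footprint of `insert α J` is `A_α ∪ xFoot J`. -/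
theorem xFoot_insert (α : Finset (Fin h) × Finset (Fin h)) (J : Finset (Finset (Fin h) × Finset (Fin h))) :
    xFoot (insert α J) = α.1 ∪ xFoot J := by
  rw [xFoot, xFoot, Finset.biUnion_insert]

/-- Disjointness of the new `x`-part from the old footprint, read off pairwise disjointness of `insert α J`. -/
theorem disjoint_xFoot_of_insert {α : Finset (Fin h) × Finset (Fin h)} {J : Finset (Finset (Fin h) × Finset (Fin h))}
    (hα : α ∉ J) (hd : ((insert α J : Finset _) : Set (Finset (Fin h) × Finset (Fin h))).PairwiseDisjoint Prod.fst) :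
    Disjoint α.1 (xFoot J) := by
  rw [Finset.coe_insert, Set.pairwiseDisjoint_insert] at hd
  rw [xFoot, Finset.disjoint_biUnion_right]
  intro β hβ
  exact hd.2 β (Finset.mem_coe.mpr hβ) (fun heq => hα (heq ▸ hβ))

/-- Pairwise disjointness of `insert α J` from that of `J` and disjointness of `A_α` from the old footprint. -/
theorem pairwiseDisjoint_insert_of {α : Finset (Fin h) × Finset (Fin h)} {J : Finset (Finset (Fin h) × Finset (Fin h))}
    (hd : (J : Set (Finset (Fin h) × Finset (Fin h))).PairwiseDisjoint Prod.fst) (hdisj : Disjoint α.1 (xFoot J)) :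
    ((insert α J : Finset _) : Set (Finset (Fin h) × Finset (Fin h))).PairwiseDisjoint Prod.fst := by
  rw [xFoot, Finset.disjoint_biUnion_right] at hdisj
  rw [Finset.coe_insert, Set.pairwiseDisjoint_insert]
  exact ⟨hd, fun β hβ _ => hdisj β (Finset.mem_coe.mp hβ)⟩

open Classical in
/-- **Closed form of the `x`-coefficient.** `xcoeff U J = 0` unless the `x`-parts of the anchors in `J` are pairwise disjoint with
union `xFoot J ⊆ U`, and then `xcoeff U J = ∏_{b ∈ U ∖ xFoot J} (Σ_{α ∈ J} φ_{α b})`: every remaining row vertex is absorbed by the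
twist of exactly one anchor of `J`, independently. -/
theorem xcoeff_eq (U : Finset (Fin h)) (J : Finset (Finset (Fin h) × Finset (Fin h))) :
    xcoeff U J =
      if (J : Set (Finset (Fin h) × Finset (Fin h))).PairwiseDisjoint Prod.fst ∧ xFoot J ⊆ U
      then ∏ b ∈ U \ xFoot J, ∑ α ∈ J, X (Sum.inr (Sum.inl (α, b))) else 0 := by
  classical
  induction J using Finset.induction_on generalizing U with
  | empty =>
    have hd0 : ((∅ : Finset (Finset (Fin h) × Finset (Fin h))) : Set (Finset (Fin h) × Finset (Fin h))).PairwiseDisjoint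
        Prod.fst := by
      rw [Finset.coe_empty]; exact Set.pairwiseDisjoint_empty
    rw [if_pos ⟨hd0, by rw [xFoot, Finset.biUnion_empty]; exact Finset.empty_subset U⟩, xFoot, Finset.biUnion_empty,
      Finset.sdiff_empty, xcoeff, Finset.prod_empty, coeff_one]
    simp_rw [Finset.sum_empty]
    rw [Finset.prod_const]
    by_cases hU : U = ∅
    · rw [hU, Finset.card_empty, pow_zero, ProductRule.pexpo_empty_empty, if_pos rfl]
    · rw [zero_pow (fun h0 => hU (Finset.card_eq_zero.mp h0)), if_neg]
      intro h0
      apply hU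
      have hle : pexpo U ∅ ≤ pexpo (∅ : Finset (Fin h)) ∅ := by rw [ProductRule.pexpo_empty_empty, ← h0]
      exact Finset.subset_empty.mp ((pexpo_le_iff U ∅ ∅ ∅).mp hle).1
  | insert α J hα ih =>
    rw [xcoeff_insert hα, xFoot_insert]
    by_cases hA : α.1 ⊆ U
    · rw [if_pos hA]
      simp_rw [ih]
      by_cases hdj : (J : Set (Finset (Fin h) × Finset (Fin h))).PairwiseDisjoint Prod.fst
      · by_cases hfoot : xFoot J ⊆ U \ α.1
        · -- the main case: both sides are `∏_{b ∈ S} (φ_{α b} + Σ_{β ∈ J} φ_{β b})`, `S = (U ∖ A) ∖ xFoot J`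
          have hdisjA : Disjoint α.1 (xFoot J) := (Finset.subset_sdiff.mp hfoot).2.symm
          have hcond : ((insert α J : Finset _) : Set (Finset (Fin h) × Finset (Fin h))).PairwiseDisjoint Prod.fst ∧
              α.1 ∪ xFoot J ⊆ U :=
            ⟨pairwiseDisjoint_insert_of hdj hdisjA, Finset.union_subset hA (hfoot.trans Finset.sdiff_subset)⟩
          rw [if_pos hcond, show U \ (α.1 ∪ xFoot J) = (U \ α.1) \ xFoot J from sdiff_sdiff_left.symm]
          set S : Finset (Fin h) := (U \ α.1) \ xFoot J with hS
          have hSsub : S ⊆ U \ α.1 := Finset.sdiff_subset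
          rw [Finset.prod_congr rfl (fun b _ => Finset.sum_insert hα), Finset.prod_add,
            show S.powerset = ((U \ α.1).powerset).filter (fun D => D ⊆ S) from ?_, Finset.sum_filter]
          · refine Finset.sum_congr rfl (fun D hD => ?_)
            rw [Finset.mem_powerset] at hD
            by_cases hDS : D ⊆ S
            · have hc : (J : Set (Finset (Fin h) × Finset (Fin h))).PairwiseDisjoint Prod.fst ∧
                  xFoot J ⊆ (U \ α.1) \ D :=
                ⟨hdj, Finset.subset_sdiff.mpr ⟨hfoot, (Finset.subset_sdiff.mp hDS).2.symm⟩⟩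
              rw [if_pos hDS, if_pos hc, xTwist, sdiff_right_comm]
            · rw [if_neg hDS, if_neg, mul_zero]
              rintro ⟨-, hf⟩
              exact hDS (Finset.subset_sdiff.mpr ⟨hD, (Finset.subset_sdiff.mp hf).2.symm⟩)
          · ext D
            simp only [Finset.mem_powerset, Finset.mem_filter]
            exact ⟨fun hD => ⟨hD.trans hSsub, hD⟩, fun hD => hD.2⟩
        · -- `xFoot J ⊄ U ∖ A`: every term vanishes, and so does the right-hand side
          rw [if_neg, Finset.sum_eq_zero]
          · intro D _
            rw [if_neg, mul_zero]
            rintro ⟨-, hf⟩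
            exact hfoot (hf.trans Finset.sdiff_subset)
          · rintro ⟨hd', hf'⟩
            exact hfoot (Finset.subset_sdiff.mpr
              ⟨Finset.subset_union_right.trans hf', (disjoint_xFoot_of_insert hα hd').symm⟩)
      · -- `J` not `x`-disjoint: both sides vanish
        rw [if_neg, Finset.sum_eq_zero]
        · intro D _
          rw [if_neg (fun hc => hdj hc.1), mul_zero]
        · rintro ⟨hd', -⟩
          exact hdj (hd'.subset (Finset.coe_subset.mpr (Finset.subset_insert α J)))
    · rw [if_neg hA, if_neg]
      rintro ⟨-, hf⟩
      exact hA (Finset.subset_union_left.trans hf)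

/-- A single anchor: `xcoeff U {α} = [A ⊆ U] · φ_α^{U ∖ A}` (the tail monomial of `…DistinctAnchorsSpec`). -/
theorem xcoeff_singleton (U : Finset (Fin h)) (α : Finset (Fin h) × Finset (Fin h)) :
    xcoeff U {α} = if α.1 ⊆ U then xTwist α (U \ α.1) else 0 := by
  classical
  rw [xcoeff_eq]
  simp only [Finset.coe_singleton, Set.pairwiseDisjoint_singleton, true_and, xFoot, Finset.singleton_biUnion,
    Finset.sum_singleton, xTwist]


/-! ## 6. The `y`-side (mirror image) -/

/-- **Recursion for the `y`-coefficient:** adding the anchor `α = (A | B)` to the set `J`,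
`ycoeff W (insert α J) = [B ⊆ W] · Σ_{D ⊆ W ∖ B} ψ_α^D · ycoeff ((W ∖ B) ∖ D) J`. -/
theorem ycoeff_insert {α : Finset (Fin h) × Finset (Fin h)} {J : Finset (Finset (Fin h) × Finset (Fin h))} (hα : α ∉ J)
    (U : Finset (Fin h)) :
    ycoeff U (insert α J) =
      if α.2 ⊆ U then ∑ D ∈ (U \ α.2).powerset, yTwist α D * ycoeff ((U \ α.2) \ D) J else 0 := by
  classical
  rw [ycoeff, Finset.prod_insert hα, yPart_eq_sum, Finset.sum_mul, coeff_sum]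
  simp_rw [coeff_monomial_mul']
  by_cases hA : α.2 ⊆ U
  · rw [if_pos hA]
    have hT : U \ α.2 ⊆ univ \ α.2 := Finset.sdiff_subset_sdiff (Finset.subset_univ U) subset_rfl
    rw [show (U \ α.2).powerset = ((univ \ α.2).powerset).filter (fun D => D ⊆ U \ α.2) from ?_, Finset.sum_filter]
    · refine Finset.sum_congr rfl (fun D hD => ?_)
      rw [Finset.mem_powerset] at hD
      by_cases hDU : D ⊆ U \ α.2
      · have hsub : α.2 ∪ D ⊆ U := Finset.union_subset hA (hDU.trans Finset.sdiff_subset)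
        rw [if_pos hDU, if_pos ((pexpo_le_iff _ _ _ _).mpr ⟨subset_rfl, hsub⟩), pexpo_sub _ _ _ _ subset_rfl hsub,
          Finset.sdiff_empty, ycoeff, sdiff_sdiff_left, Finset.sup_eq_union]
      · rw [if_neg hDU, if_neg]
        intro hle
        apply hDU
        have hAD := ((pexpo_le_iff _ _ _ _).mp hle).2
        intro b hb
        rw [Finset.mem_sdiff]
        refine ⟨hAD (Finset.mem_union_right _ hb), fun hbA => ?_⟩
        have hb' := hD hb
        rw [Finset.mem_sdiff] at hb'
        exact hb'.2 hbA
    · ext D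
      simp only [Finset.mem_powerset, Finset.mem_filter]
      exact ⟨fun hD => ⟨hD.trans hT, hD⟩, fun hD => hD.2⟩
  · rw [if_neg hA]
    refine Finset.sum_eq_zero (fun D _ => ?_)
    rw [if_neg]
    intro hle
    exact hA (Finset.subset_union_left.trans ((pexpo_le_iff _ _ _ _).mp hle).2)

/-- The `y`-footprint of a set of anchors: `⋃_{α ∈ J} B_α`. -/
def yFoot (J : Finset (Finset (Fin h) × Finset (Fin h))) : Finset (Fin h) := J.biUnion Prod.snd

/-- The `y`-footprint of `insert α J` is `B_α ∪ yFoot J`. -/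
theorem yFoot_insert (α : Finset (Fin h) × Finset (Fin h)) (J : Finset (Finset (Fin h) × Finset (Fin h))) :
    yFoot (insert α J) = α.2 ∪ yFoot J := by
  rw [yFoot, yFoot, Finset.biUnion_insert]

/-- Disjointness of the new `y`-part from the old footprint, read off pairwise disjointness of `insert α J`. -/
theorem disjoint_yFoot_of_insert {α : Finset (Fin h) × Finset (Fin h)} {J : Finset (Finset (Fin h) × Finset (Fin h))}
    (hα : α ∉ J) (hd : ((insert α J : Finset _) : Set (Finset (Fin h) × Finset (Fin h))).PairwiseDisjoint Prod.snd) :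
    Disjoint α.2 (yFoot J) := by
  rw [Finset.coe_insert, Set.pairwiseDisjoint_insert] at hd
  rw [yFoot, Finset.disjoint_biUnion_right]
  intro β hβ
  exact hd.2 β (Finset.mem_coe.mpr hβ) (fun heq => hα (heq ▸ hβ))

/-- Pairwise disjointness of `insert α J` from that of `J` and disjointness of `B_α` from the old footprint. -/
theorem pairwiseDisjoint_insert_of_y {α : Finset (Fin h) × Finset (Fin h)} {J : Finset (Finset (Fin h) × Finset (Fin h))}
    (hd : (J : Set (Finset (Fin h) × Finset (Fin h))).PairwiseDisjoint Prod.snd) (hdisj : Disjoint α.2 (yFoot J)) :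
    ((insert α J : Finset _) : Set (Finset (Fin h) × Finset (Fin h))).PairwiseDisjoint Prod.snd := by
  rw [yFoot, Finset.disjoint_biUnion_right] at hdisj
  rw [Finset.coe_insert, Set.pairwiseDisjoint_insert]
  exact ⟨hd, fun β hβ _ => hdisj β (Finset.mem_coe.mp hβ)⟩

open Classical in
/-- **Closed form of the `y`-coefficient.** `ycoeff U J = 0` unless the `x`-parts of the anchors in `J` are pairwise disjoint with
union `yFoot J ⊆ U`, and then `ycoeff U J = ∏_{b ∈ U ∖ yFoot J} (Σ_{α ∈ J} φ_{α b})`: every remaining row vertex is absorbed by the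
twist of exactly one anchor of `J`, independently. -/
theorem ycoeff_eq (U : Finset (Fin h)) (J : Finset (Finset (Fin h) × Finset (Fin h))) :
    ycoeff U J =
      if (J : Set (Finset (Fin h) × Finset (Fin h))).PairwiseDisjoint Prod.snd ∧ yFoot J ⊆ U
      then ∏ b ∈ U \ yFoot J, ∑ α ∈ J, X (Sum.inr (Sum.inr (α, b))) else 0 := by
  classical
  induction J using Finset.induction_on generalizing U with
  | empty =>
    have hd0 : ((∅ : Finset (Finset (Fin h) × Finset (Fin h))) : Set (Finset (Fin h) × Finset (Fin h))).PairwiseDisjoint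
        Prod.snd := by
      rw [Finset.coe_empty]; exact Set.pairwiseDisjoint_empty
    rw [if_pos ⟨hd0, by rw [yFoot, Finset.biUnion_empty]; exact Finset.empty_subset U⟩, yFoot, Finset.biUnion_empty,
      Finset.sdiff_empty, ycoeff, Finset.prod_empty, coeff_one]
    simp_rw [Finset.sum_empty]
    rw [Finset.prod_const]
    by_cases hU : U = ∅
    · rw [hU, Finset.card_empty, pow_zero, ProductRule.pexpo_empty_empty, if_pos rfl]
    · rw [zero_pow (fun h0 => hU (Finset.card_eq_zero.mp h0)), if_neg]
      intro h0
      apply hU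
      have hle : pexpo ∅ U ≤ pexpo ∅ (∅ : Finset (Fin h)) := by rw [ProductRule.pexpo_empty_empty, ← h0]
      exact Finset.subset_empty.mp ((pexpo_le_iff ∅ U ∅ ∅).mp hle).2
  | insert α J hα ih =>
    rw [ycoeff_insert hα, yFoot_insert]
    by_cases hA : α.2 ⊆ U
    · rw [if_pos hA]
      simp_rw [ih]
      by_cases hdj : (J : Set (Finset (Fin h) × Finset (Fin h))).PairwiseDisjoint Prod.snd
      · by_cases hfoot : yFoot J ⊆ U \ α.2
        · -- the main case: both sides are `∏_{b ∈ S} (φ_{α b} + Σ_{β ∈ J} φ_{β b})`, `S = (U ∖ A) ∖ yFoot J`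
          have hdisjA : Disjoint α.2 (yFoot J) := (Finset.subset_sdiff.mp hfoot).2.symm
          have hcond : ((insert α J : Finset _) : Set (Finset (Fin h) × Finset (Fin h))).PairwiseDisjoint Prod.snd ∧
              α.2 ∪ yFoot J ⊆ U :=
            ⟨pairwiseDisjoint_insert_of_y hdj hdisjA, Finset.union_subset hA (hfoot.trans Finset.sdiff_subset)⟩
          rw [if_pos hcond, show U \ (α.2 ∪ yFoot J) = (U \ α.2) \ yFoot J from sdiff_sdiff_left.symm]
          set S : Finset (Fin h) := (U \ α.2) \ yFoot J with hS
          have hSsub : S ⊆ U \ α.2 := Finset.sdiff_subset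
          rw [Finset.prod_congr rfl (fun b _ => Finset.sum_insert hα), Finset.prod_add,
            show S.powerset = ((U \ α.2).powerset).filter (fun D => D ⊆ S) from ?_, Finset.sum_filter]
          · refine Finset.sum_congr rfl (fun D hD => ?_)
            rw [Finset.mem_powerset] at hD
            by_cases hDS : D ⊆ S
            · have hc : (J : Set (Finset (Fin h) × Finset (Fin h))).PairwiseDisjoint Prod.snd ∧
                  yFoot J ⊆ (U \ α.2) \ D :=
                ⟨hdj, Finset.subset_sdiff.mpr ⟨hfoot, (Finset.subset_sdiff.mp hDS).2.symm⟩⟩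
              rw [if_pos hDS, if_pos hc, yTwist, sdiff_right_comm]
            · rw [if_neg hDS, if_neg, mul_zero]
              rintro ⟨-, hf⟩
              exact hDS (Finset.subset_sdiff.mpr ⟨hD, (Finset.subset_sdiff.mp hf).2.symm⟩)
          · ext D
            simp only [Finset.mem_powerset, Finset.mem_filter]
            exact ⟨fun hD => ⟨hD.trans hSsub, hD⟩, fun hD => hD.2⟩
        · -- `yFoot J ⊄ U ∖ A`: every term vanishes, and so does the right-hand side
          rw [if_neg, Finset.sum_eq_zero]
          · intro D _
            rw [if_neg, mul_zero]
            rintro ⟨-, hf⟩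
            exact hfoot (hf.trans Finset.sdiff_subset)
          · rintro ⟨hd', hf'⟩
            exact hfoot (Finset.subset_sdiff.mpr
              ⟨Finset.subset_union_right.trans hf', (disjoint_yFoot_of_insert hα hd').symm⟩)
      · -- `J` not `y`-disjoint: both sides vanish
        rw [if_neg, Finset.sum_eq_zero]
        · intro D _
          rw [if_neg (fun hc => hdj hc.1), mul_zero]
        · rintro ⟨hd', -⟩
          exact hdj (hd'.subset (Finset.coe_subset.mpr (Finset.subset_insert α J)))
    · rw [if_neg hA, if_neg]
      rintro ⟨-, hf⟩
      exact hA (Finset.subset_union_left.trans hf)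

/-- A single anchor: `ycoeff W {α} = [B ⊆ W] · ψ_α^{W ∖ B}`. -/
theorem ycoeff_singleton (U : Finset (Fin h)) (α : Finset (Fin h) × Finset (Fin h)) :
    ycoeff U {α} = if α.2 ⊆ U then yTwist α (U \ α.2) else 0 := by
  classical
  rw [ycoeff_eq]
  simp only [Finset.coe_singleton, Set.pairwiseDisjoint_singleton, true_and, yFoot, Finset.singleton_biUnion,
    Finset.sum_singleton, yTwist]

end AnchorSets

end

end Summit.ValiantsHypothesis.ValiantsHypothesis.Theorems.BarrierLever.AnchoredPeeling
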